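import Summits.CriticalPhenomena.PercolationContinuityZ3.Theorems.PercNearOneGluingNoHeavyPcintNawGrowth
import Summits.CriticalPhenomena.PercolationContinuityZ3.Theorems.PercNearOneGluingNoHeavyPcintClassCountLaw
import HarnessLib

/-!
# CriticalPhenomena/PercolationContinuityZ3 — Theorems/PercNearOneGluingNoHeavyPcintNawMemoryTail.lean:
# the memory-tail LIMIT LAW for the site column B2 — `μ^NAW_τ(d) ↓ μ_NAW(ℤ^d)` (the neighbour-avoiding twin of Madras–Slade Lemma 1.2.3)

Lane prim-pcint, seat prim-pcint-2, STRUCTURE rule (run/shared/lean/prim/pcint/STRUCTURE.md §2, conjecture C1′: "for every d ≥ 2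
and every finite-memory walk-counting rule of the lane (B1 pure memory, B2 NAW memory, B3m, B2d) … lim_τ p*_d(τ) exists").  For
B1 the clause "the limit exists and is `1/μ`" is the theorem `MemoryTail.tendsto_memGrowth` (gen 13) with `MemoryTail.iSup_inv_memGrowth`
(gen 15); this file proves the same clause for the pure neighbour-avoidance memory rule B2 of the SITE column, whose objects
(`NawTail.nawCount`, `nawConst = μ_NAW`) are in …PcintNawGrowth.  HONEST FRAMING: elementary (submultiplicativity + Fekete + a
squeeze); the RATE clause of C1′ for B2 (θ_d = max(2, d/2)) stays a conjecture; nothing here moves a certified cell.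

THE OBJECTS.  A step word has NEIGHBOUR-AVOIDANCE MEMORY `τ` (`IsNawMem τ`) if any two of its sites at most `τ` steps apart are
distinct and, when two or more steps apart, not lattice neighbours — the words accepted by the lane's memory-`τ` induced-walk
automata (kind `naw_cw`; REDUCTIONS.md §R2/§B2).  `nawMemCount d τ n = N_{n,τ}`; `N_{n+m,τ} ≤ N_{n,τ} N_{m,τ}`; `μ^NAW_τ(d) :=
nawMemGrowth d τ = inf_n N_{n,τ}^{1/n} = lim` (Fekete, `tendsto_nawMemCount_rpow`) — the growth constants whose reciprocals are the
B2 site cells (engine values on `ℤ³`: 4.09969 at memory 14 ⇒ `p_c^site(ℤ³) ≥ 0.2439` two-engine, STEP-0; 4.0837564 at memory 20).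

THE LAW (limit clause).  `μ_NAW ≤ μ^NAW_τ ≤ N_τ^{1/τ}` (`N_{n,τ} = N_n` for `n ≤ τ`) and `N_τ^{1/τ} → μ_NAW`, hence
**`μ^NAW_τ(d) → μ_NAW(ℤ^d)`** (`tendsto_nawMemGrowth`), antitonely; the B2 column `1/μ^NAW_τ` increases to exactly `1/μ_NAW(ℤ^d)`
(`tendsto_inv_nawMemGrowth`, `iSup_inv_nawMemGrowth`), each rung and the limit being bounds on `p_c^site(ℤ^d)`
(`inv_nawMemGrowth_le_siteCriticalProb`, `NawTail.inv_nawConst_le_siteCriticalProb`).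

Main results (namespace `Summit.CriticalPhenomena.PercolationContinuityZ3.Theorems.Pcint.NawTail`):
* `IsNawMem`, `isNawMem_of_isNAW`, `IsNawMem.anti`, `nawMemWords`, `nawMemCount`, `nawCount_le_nawMemCount`, `nawMemCount_le_of_le`,
  `nawMemCount_le_pow`; `nawMemGrowth` (`μ^NAW_τ`), `nawConst_le_nawMemGrowth`, `nawMemGrowth_antitone`, `nawMemGrowth_le`;
* `isNawMem_even_iff`, `nawMemWords_even_eq`, `nawMemCount_even_eq`, **`nawMemGrowth_even_eq`** (`μ^NAW_{2k} = μ^NAW_{2k−1}`, k ≥ 2: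
  the SHIFTED PARITY LAW of the site column — referee gen 92's theorem-for-free, the `μ`-half of the pre-registered P14h);
* `isNawMem_prefix`, `isNawMem_suffix`, `nawMemCount_add_le`, `tendsto_nawMemCount_rpow` (`μ^NAW_τ = lim N_{n,τ}^{1/n}`);
* `isNAW_of_isNawMem`, `nawMemCount_eq_nawCount` (`n ≤ τ`), `nawMemGrowth_le_nawCount_rpow`, **`tendsto_nawMemGrowth`**,
  `nawLogRatio`, `nawLogRatio_nonneg`, `tendsto_nawLogRatio`;
* `nawMemGrowth_pos`, `inv_nawMemGrowth_le_siteCriticalProb`, `inv_nawMemGrowth_monotone`, `tendsto_inv_nawMemGrowth`,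
  `iSup_inv_nawMemGrowth`.

All PROVED (no `sorry`, no named fact).  Written by prim-pcint-2 gen 15 (prover-prim-pcint-2-g15-0), 2026-08-23.
-/

noncomputable section

open Filter Topology MeasureTheory
open Literature.Probability.LatticeModels Literature.Probability.Percolation
open Literature.Probability.RandomPlanarGeometry.SAW.Zd

namespace Summit.CriticalPhenomena.PercolationContinuityZ3.Theorems.Pcint.NawTail

variable {d : ℕ}

/-! ### Words with neighbour-avoidance memory `τ` -/

/-- A step word has **neighbour-avoidance memory `τ`**: two sites at most `τ` steps apart are distinct, and not lattice
neighbours when two or more steps apart (the window version of `IsNAW`; `τ = 0`: no constraint). [folklore] -/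
def IsNawMem (τ : ℕ) {n : ℕ} (w : Fin n → Fin d × Bool) : Prop :=
  ∀ i j : ℕ, j ≤ n → i < j → j ≤ i + τ →
    wordPos w i ≠ wordPos w j ∧ (i + 2 ≤ j → ¬ (zdGraph d).Adj (wordPos w i) (wordPos w j))

/-- A NAW has every finite neighbour-avoidance memory. [folklore] -/
theorem isNawMem_of_isNAW (τ : ℕ) {n : ℕ} {w : Fin n → Fin d × Bool} (h : IsNAW w) : IsNawMem τ w :=
  fun i j hj hij _ => ⟨fun heq => absurd (h.1 i j (by omega) hj heq) (by omega), fun h2 => h.2 i j h2 hj⟩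

/-- A longer memory is a stronger constraint. [folklore] -/
theorem IsNawMem.anti {τ₁ τ₂ : ℕ} (hτ : τ₁ ≤ τ₂) {n : ℕ} {w : Fin n → Fin d × Bool} (h : IsNawMem τ₂ w) :
    IsNawMem τ₁ w :=
  fun i j hj hij hτ' => h i j hj hij (by omega)

open Classical in
/-- The step words of length `n` with neighbour-avoidance memory `τ`. [folklore] -/
def nawMemWords (d τ n : ℕ) : Finset (Fin n → Fin d × Bool) :=
  Finset.univ.filter fun w => IsNawMem τ w

/-- `N_{n,τ}(d)`, the number of `n`-step words with neighbour-avoidance memory `τ`. [folklore] -/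
def nawMemCount (d τ n : ℕ) : ℕ := (nawMemWords d τ n).card

open Classical in
/-- Membership in `nawMemWords`. [folklore] -/
@[simp] theorem mem_nawMemWords {τ n : ℕ} {w : Fin n → Fin d × Bool} : w ∈ nawMemWords d τ n ↔ IsNawMem τ w := by
  simp [nawMemWords]

/-- `nawWords ⊆ nawMemWords`. [folklore] -/
theorem nawWords_subset_nawMemWords (d τ n : ℕ) : nawWords d n ⊆ nawMemWords d τ n := by
  intro w hw
  rw [mem_nawWords] at hw
  exact mem_nawMemWords.2 (isNawMem_of_isNAW τ hw)

/-- `nawMemWords τ₂ ⊆ nawMemWords τ₁` for `τ₁ ≤ τ₂`. [folklore] -/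
theorem nawMemWords_subset_of_le {τ₁ τ₂ : ℕ} (h : τ₁ ≤ τ₂) (d n : ℕ) : nawMemWords d τ₂ n ⊆ nawMemWords d τ₁ n := by
  intro w hw
  rw [mem_nawMemWords] at hw ⊢
  exact hw.anti h

/-- `N_n ≤ N_{n,τ}`. [folklore] -/
theorem nawCount_le_nawMemCount (d τ n : ℕ) : nawCount d n ≤ nawMemCount d τ n :=
  Finset.card_le_card (nawWords_subset_nawMemWords d τ n)

/-- `N_{n,τ₂} ≤ N_{n,τ₁}` for `τ₁ ≤ τ₂`. [folklore] -/
theorem nawMemCount_le_of_le {τ₁ τ₂ : ℕ} (h : τ₁ ≤ τ₂) (d n : ℕ) : nawMemCount d τ₂ n ≤ nawMemCount d τ₁ n :=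
  Finset.card_le_card (nawMemWords_subset_of_le h d n)

/-- `N_{n,τ} ≤ (2d)^n`. [folklore] -/
theorem nawMemCount_le_pow (d τ n : ℕ) : nawMemCount d τ n ≤ (2 * d) ^ n := by
  classical
  calc nawMemCount d τ n ≤ (Finset.univ : Finset (Fin n → Fin d × Bool)).card :=
        Finset.card_le_card (Finset.filter_subset _ _)
    _ = (2 * d) ^ n := by simp [Finset.card_univ, Fintype.card_prod, mul_comm]

/-- `1 ≤ N_{n,τ}` (`d ≥ 1`). [folklore] -/
theorem one_le_nawMemCount [NeZero d] (τ n : ℕ) : 1 ≤ nawMemCount d τ n :=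
  (one_le_nawCount n).trans (nawCount_le_nawMemCount d τ n)

/-! ### The growth constants `μ^NAW_τ(d)` -/

/-- **`μ^NAW_τ(d)`**, the growth constant of the words with neighbour-avoidance memory `τ`, in the infimum form
`⨅ₙ N_{n+1,τ}^{1/(n+1)}` (`= lim N_{n,τ}^{1/n}`, `tendsto_nawMemCount_rpow`): the Perron root of the lane's memory-`τ`
induced-walk automaton.  CONVENTION (referee gen 92): this is the ENGINE site convention — `nawMemGrowth d τ` is the column
`mu_tau` of gen12/DATA.txt '== site d' (memmu `site=1`; e.g. `d = 3`: 4.172331 at τ = 6, 4.099684 at τ = 14, 4.083756 at τ = 20), in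
which `2k ≡ 2k − 1` (`nawMemGrowth_even_eq` below); pcint-1's Lean `nstep (2k)` is the same automaton, with `nstep (2k+1) = nstep (2k)`.
[folklore] -/
def nawMemGrowth (d τ : ℕ) : ℝ :=
  ⨅ n : ℕ, (nawMemCount d τ (n + 1) : ℝ) ^ (1 / ((n : ℝ) + 1))

/-- The terms are bounded below (by `0`). [folklore] -/
theorem bddBelow_nawMemRpow (d τ : ℕ) :
    BddBelow (Set.range fun n : ℕ => (nawMemCount d τ (n + 1) : ℝ) ^ (1 / ((n : ℝ) + 1))) :=
  ⟨0, by rintro _ ⟨m, rfl⟩; exact Real.rpow_nonneg (Nat.cast_nonneg _) _⟩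

/-- `μ^NAW_τ(d) ≥ 0`. [folklore] -/
theorem nawMemGrowth_nonneg (d τ : ℕ) : 0 ≤ nawMemGrowth d τ :=
  Real.iInf_nonneg fun _ => Real.rpow_nonneg (Nat.cast_nonneg _) _

/-- **`μ_NAW(ℤ^d) ≤ μ^NAW_τ(d)`** for every memory `τ`. [folklore] -/
theorem nawConst_le_nawMemGrowth (d τ : ℕ) : nawConst d ≤ nawMemGrowth d τ := by
  refine le_ciInf fun n => (ciInf_le (bddBelow_nawRpow d) n).trans ?_
  exact Real.rpow_le_rpow (Nat.cast_nonneg _) (by exact_mod_cast nawCount_le_nawMemCount d τ (n + 1)) (by positivity)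

/-- `μ^NAW_{τ₂}(d) ≤ μ^NAW_{τ₁}(d)` for `τ₁ ≤ τ₂`. [folklore] -/
theorem nawMemGrowth_antitone {τ₁ τ₂ : ℕ} (h : τ₁ ≤ τ₂) (d : ℕ) : nawMemGrowth d τ₂ ≤ nawMemGrowth d τ₁ := by
  refine le_ciInf fun n => (ciInf_le (bddBelow_nawMemRpow d τ₂) n).trans ?_
  exact Real.rpow_le_rpow (Nat.cast_nonneg _) (by exact_mod_cast nawMemCount_le_of_le h d (n + 1)) (by positivity)

/-- `μ^NAW_τ(d) ≤ 2d`. [folklore] -/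
theorem nawMemGrowth_le (d τ : ℕ) : nawMemGrowth d τ ≤ 2 * d := by
  refine (ciInf_le (bddBelow_nawMemRpow d τ) 0).trans ?_
  have h : (nawMemCount d τ 1 : ℝ) ≤ 2 * d := by exact_mod_cast (nawMemCount_le_pow d τ 1).trans_eq (pow_one _)
  simpa using h

/-- `μ^NAW_τ ≤ N_{n,τ}^{1/n}` for `n ≥ 1`. [folklore] -/
theorem nawMemGrowth_le_rpow (d τ : ℕ) {n : ℕ} (hn : n ≠ 0) :
    nawMemGrowth d τ ≤ (nawMemCount d τ n : ℝ) ^ (1 / (n : ℝ)) := by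
  obtain ⟨m, rfl⟩ : ∃ m, n = m + 1 := ⟨n - 1, by omega⟩
  have h := ciInf_le (bddBelow_nawMemRpow d τ) m
  simpa [nawMemGrowth, Nat.cast_succ] using h

/-! ### The shifted parity law (referee gen 92; the `μ`-half of P14h): even memory `2k` = odd memory `2k − 1` -/

/-- **`IsNawMem (2k) w ↔ IsNawMem (2k−1) w`** for `k ≥ 2`: the only new constraints at memory `2k` are at gap exactly `2k`;
an ADJACENCY at an even gap is impossible (`ℓ¹`-parity of `ω(j) − ω(i)` is the parity of `j − i`), and a COINCIDENCE `ω(i) = ω(i+2k)`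
would make `ω(i+2k−1)` a lattice neighbour of `ω(i)` at gap `2k − 1 ≥ 3`, already excluded at memory `2k − 1`. [folklore] -/
theorem isNawMem_even_iff {k : ℕ} (hk : 2 ≤ k) {n : ℕ} (w : Fin n → Fin d × Bool) :
    IsNawMem (2 * k) w ↔ IsNawMem (2 * k - 1) w := by
  refine ⟨fun h => h.anti (by omega), fun h i j hj hij hτ => ?_⟩
  by_cases hgap : j ≤ i + (2 * k - 1)
  · exact h i j hj hij hgap
  · have hjk : j = i + 2 * k := by omega
    refine ⟨fun heq => ?_, fun _ hadj => ?_⟩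
    · -- coincidence at gap 2k ⇒ adjacency at gap 2k − 1
      obtain ⟨j', rfl⟩ : ∃ j', j = j' + 1 := ⟨j - 1, by omega⟩
      have hstep : wordPos w (j' + 1) = wordPos w j' + stepVec (w ⟨j', by omega⟩) := wordPos_succ w (by omega)
      have hadj : (zdGraph d).Adj (wordPos w i) (wordPos w j') := by
        rw [heq]
        exact ((zdGraph_adj_iff_stepVec _ _).2 ⟨_, hstep⟩).symm
      exact (h i j' (by omega) (by omega) (by omega)).2 (by omega) hadj
    · -- adjacency at an even gap contradicts parity
      obtain ⟨a, ha⟩ := (zdGraph_adj_iff_stepVec _ _).1 hadj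
      have hodd := l1_sub_stepVec_add_odd (wordPos w j) a
      rw [show wordPos w j - stepVec a = wordPos w i from by rw [ha, add_sub_cancel_right]] at hodd
      have hpi := MemoryTail.l1_wordPos_mod_two w i (by omega)
      have hpj := MemoryTail.l1_wordPos_mod_two w j hj
      omega

/-- Hence `nawMemWords d (2k) n = nawMemWords d (2k−1) n` (`k ≥ 2`). [folklore] -/
theorem nawMemWords_even_eq {k : ℕ} (hk : 2 ≤ k) (d n : ℕ) : nawMemWords d (2 * k) n = nawMemWords d (2 * k - 1) n := by
  classical
  unfold nawMemWords
  exact Finset.filter_congr fun w _ => isNawMem_even_iff hk w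

/-- `N_{n,2k} = N_{n,2k−1}` (`k ≥ 2`). [folklore] -/
theorem nawMemCount_even_eq {k : ℕ} (hk : 2 ≤ k) (d n : ℕ) : nawMemCount d (2 * k) n = nawMemCount d (2 * k - 1) n := by
  rw [nawMemCount, nawMemCount, nawMemWords_even_eq hk]

/-- **The shifted parity law of the site column, `μ`-half (P14h): `μ^NAW_{2k}(d) = μ^NAW_{2k−1}(d)`** for `k ≥ 2` — an even
memory adds nothing over the preceding odd one (for the bond automaton it is the odd memory that adds nothing, `mstep_odd_eq`).
Pre-registered and checked on the engines: memmu site d = 3, τ = 5/7/9/11/13 = the τ = 6/…/14 values to 12 digits (P14h). [folklore] -/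
theorem nawMemGrowth_even_eq {k : ℕ} (hk : 2 ≤ k) (d : ℕ) : nawMemGrowth d (2 * k) = nawMemGrowth d (2 * k - 1) := by
  unfold nawMemGrowth
  simp_rw [nawMemCount_even_eq hk]

/-! ### Submultiplicativity and `μ^NAW_τ = lim N_{n,τ}^{1/n}` -/

/-- The first `N` steps of a word with neighbour-avoidance memory `τ` have memory `τ`. [folklore] -/
theorem isNawMem_prefix {τ N M : ℕ} {w : Fin (N + M) → Fin d × Bool} (h : IsNawMem τ w) :
    IsNawMem τ (fun i : Fin N => w (Fin.castAdd M i)) := by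
  intro i j hj hij hτ
  rw [MemoryTail.wordPos_prefix w i (by omega), MemoryTail.wordPos_prefix w j hj]
  exact h i j (by omega) hij hτ

/-- The last `M` steps of a word with neighbour-avoidance memory `τ` have memory `τ` (translation invariance). [folklore] -/
theorem isNawMem_suffix {τ N M : ℕ} {w : Fin (N + M) → Fin d × Bool} (h : IsNawMem τ w) :
    IsNawMem τ (fun i : Fin M => w (Fin.natAdd N i)) := by
  intro i j hj hij hτ
  rw [MemoryTail.wordPos_suffix w i (by omega), MemoryTail.wordPos_suffix w j hj, zdGraph_adj_sub_right]
  obtain ⟨h1, h2⟩ := h (N + i) (N + j) (by omega) (by omega) (by omega)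
  exact ⟨fun heq => h1 (sub_left_injective heq), fun hij2 => h2 (by omega)⟩

/-- **`N_{N+M,τ} ≤ N_{N,τ} · N_{M,τ}`**. [folklore] -/
theorem nawMemCount_add_le (d τ N M : ℕ) : nawMemCount d τ (N + M) ≤ nawMemCount d τ N * nawMemCount d τ M := by
  classical
  rw [nawMemCount, nawMemCount, nawMemCount, ← Finset.card_product]
  refine Finset.card_le_card_of_injOn
    (fun w => ((fun i : Fin N => w (Fin.castAdd M i)), (fun i : Fin M => w (Fin.natAdd N i))))
    (fun w hw => ?_) (fun w hw w' hw' h => ?_)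
  · rw [Finset.mem_coe, mem_nawMemWords] at hw
    rw [Finset.mem_coe, Finset.mem_product, mem_nawMemWords, mem_nawMemWords]
    exact ⟨isNawMem_prefix hw, isNawMem_suffix hw⟩
  · simp only [Prod.mk.injEq] at h
    funext i
    refine Fin.addCases (fun j => ?_) (fun j => ?_) i
    · exact congrFun h.1 j
    · exact congrFun h.2 j

/-- **`N_{n,τ}^{1/n} → μ^NAW_τ(d)`** (`d ≥ 1`; Fekete). [folklore] -/
theorem tendsto_nawMemCount_rpow [NeZero d] (τ : ℕ) :
    Tendsto (fun n : ℕ => (nawMemCount d τ n : ℝ) ^ (1 / (n : ℝ))) atTop (𝓝 (nawMemGrowth d τ)) := by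
  have hpos : ∀ n, (0 : ℝ) < nawMemCount d τ n := fun n => by exact_mod_cast one_le_nawMemCount τ n
  have hu : Subadditive fun n => Real.log (nawMemCount d τ n) := by
    intro m n
    rw [← Real.log_mul (hpos m).ne' (hpos n).ne']
    apply Real.log_le_log (hpos _)
    exact_mod_cast nawMemCount_add_le d τ m n
  have hbdd : BddBelow (Set.range fun n : ℕ => Real.log (nawMemCount d τ n) / n) := by
    refine ⟨0, ?_⟩
    rintro _ ⟨n, rfl⟩
    exact div_nonneg (Real.log_nonneg (by exact_mod_cast one_le_nawMemCount τ n)) (Nat.cast_nonneg n)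
  have hlim := hu.tendsto_lim hbdd
  have key : ∀ n : ℕ, (nawMemCount d τ n : ℝ) ^ (1 / (n : ℝ)) = Real.exp (Real.log (nawMemCount d τ n) / n) :=
    fun n => by rw [Real.rpow_def_of_pos (hpos n), mul_one_div]
  have hexp : Tendsto (fun n : ℕ => Real.exp (Real.log (nawMemCount d τ n) / n)) atTop
      (𝓝 (Real.exp hu.lim)) :=
    (Real.continuous_exp.tendsto _).comp hlim
  have heq : (fun n : ℕ => (nawMemCount d τ n : ℝ) ^ (1 / (n : ℝ))) =
      fun n => Real.exp (Real.log (nawMemCount d τ n) / n) := funext key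
  rw [heq]
  convert hexp using 2
  apply le_antisymm
  · refine ge_of_tendsto hexp ?_
    filter_upwards [eventually_ge_atTop 1] with n hn
    rw [← key n]
    exact nawMemGrowth_le_rpow d τ (by omega)
  · refine le_ciInf fun n => ?_
    have h1 := hu.lim_le_div hbdd (Nat.succ_ne_zero n)
    have h2 := Real.exp_le_exp.2 h1
    rw [← key (n + 1)] at h2
    simpa [Nat.cast_succ] using h2

/-! ### `N_{n,τ} = N_n` for `n ≤ τ`, the squeeze, and `μ^NAW_τ → μ_NAW` -/

/-- A word of length `n ≤ τ` with neighbour-avoidance memory `τ` is a NAW (all pairs of times are inside the window). [folklore] -/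
theorem isNAW_of_isNawMem {τ n : ℕ} (hn : n ≤ τ) {w : Fin n → Fin d × Bool} (h : IsNawMem τ w) : IsNAW w := by
  refine ⟨fun i j hi hj hij => ?_, fun i j hij hjn => (h i j hjn (by omega) (by omega)).2 hij⟩
  by_contra hne
  rcases Nat.lt_or_gt_of_ne hne with hlt | hlt
  · exact (h i j hj hlt (by omega)).1 hij
  · exact (h j i hi hlt (by omega)).1 hij.symm

/-- For `n ≤ τ` the memory-`τ` words are exactly the NAWs. [folklore] -/
theorem nawMemWords_eq_nawWords {τ n : ℕ} (hn : n ≤ τ) (d : ℕ) : nawMemWords d τ n = nawWords d n := by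
  refine Finset.Subset.antisymm (fun w hw => ?_) (nawWords_subset_nawMemWords d τ n)
  rw [mem_nawMemWords] at hw
  exact mem_nawWords.2 (isNAW_of_isNawMem hn hw)

/-- `N_{n,τ} = N_n` for `n ≤ τ`. [folklore] -/
theorem nawMemCount_eq_nawCount {τ n : ℕ} (hn : n ≤ τ) (d : ℕ) : nawMemCount d τ n = nawCount d n := by
  rw [nawMemCount, nawMemWords_eq_nawWords hn, nawCount]

/-- **`μ^NAW_τ(d) ≤ N_τ^{1/τ}`** for `τ ≥ 1` (the `n = τ` term of the infimum). [folklore] -/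
theorem nawMemGrowth_le_nawCount_rpow {τ : ℕ} (hτ : 1 ≤ τ) (d : ℕ) :
    nawMemGrowth d τ ≤ (nawCount d τ : ℝ) ^ (1 / (τ : ℝ)) := by
  have h := nawMemGrowth_le_rpow d τ (n := τ) (by omega)
  rwa [nawMemCount_eq_nawCount le_rfl] at h

/-- **The memory-tail limit law for B2: `μ^NAW_τ(d) → μ_NAW(ℤ^d)` as `τ → ∞`** (`d ≥ 1`), by the squeeze
`μ_NAW ≤ μ^NAW_τ ≤ N_τ^{1/τ} → μ_NAW` — the neighbour-avoiding twin of Madras–Slade Lemma 1.2.3. [folklore] -/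
theorem tendsto_nawMemGrowth [NeZero d] :
    Tendsto (fun τ : ℕ => nawMemGrowth d τ) atTop (𝓝 (nawConst d)) := by
  refine tendsto_of_tendsto_of_tendsto_of_le_of_le' tendsto_const_nhds tendsto_nawCount_rpow
    (Eventually.of_forall fun τ => nawConst_le_nawMemGrowth d τ) ?_
  filter_upwards [eventually_ge_atTop 1] with τ hτ using nawMemGrowth_le_nawCount_rpow hτ d

/-- `μ^NAW_τ(d) > 0` (`d ≥ 1`). [folklore] -/
theorem nawMemGrowth_pos [NeZero d] (τ : ℕ) : 0 < nawMemGrowth d τ :=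
  nawConst_pos.trans_le (nawConst_le_nawMemGrowth d τ)

/-- The B2 analogue of the C1′ quantity: `L^NAW_d(τ) := ln(μ^NAW_τ(d)/μ_NAW(ℤ^d))`. [folklore] -/
def nawLogRatio (d τ : ℕ) : ℝ := Real.log (nawMemGrowth d τ / nawConst d)

/-- `L^NAW_d(τ) ≥ 0`. [folklore] -/
theorem nawLogRatio_nonneg [NeZero d] (τ : ℕ) : 0 ≤ nawLogRatio d τ :=
  Real.log_nonneg ((one_le_div nawConst_pos).2 (nawConst_le_nawMemGrowth d τ))

/-- `L^NAW_d(τ) → 0` as `τ → ∞` (the quantity whose RATE the B2 clause of C1′ describes tends to zero). [folklore] -/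
theorem tendsto_nawLogRatio [NeZero d] : Tendsto (fun τ : ℕ => nawLogRatio d τ) atTop (𝓝 0) := by
  have hμ := nawConst_pos (d := d)
  have h1 : Tendsto (fun τ : ℕ => nawMemGrowth d τ / nawConst d) atTop (𝓝 1) := by
    have := (tendsto_nawMemGrowth (d := d)).div_const (nawConst d)
    rwa [div_self hμ.ne'] at this
  have h2 := ((Real.continuousAt_log one_ne_zero).tendsto).comp h1
  rw [Real.log_one] at h2
  exact h2

/-! ### The B2 site column: every rung `1/μ^NAW_τ` is a bound and the rungs increase to exactly `1/μ_NAW` -/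

/-- **Every B2 rung is a bound**: `1/μ^NAW_τ(d) ≤ 1/μ_NAW(ℤ^d) ≤ p_c^site(ℤ^d)`; the lane's two-engine STEP-0 site cell
`p_c^site(ℤ³) ≥ 0.2439 = 1/4.09969` (memory 14) and the kernel `naw_cw` rows are rational roundings of such rungs. [folklore] -/
theorem inv_nawMemGrowth_le_siteCriticalProb [NeZero d] (τ : ℕ) :
    (nawMemGrowth d τ)⁻¹ ≤ siteCriticalProb (zdGraph d) 0 :=
  (inv_anti₀ nawConst_pos (nawConst_le_nawMemGrowth d τ)).trans inv_nawConst_le_siteCriticalProb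

/-- The rungs `1/μ^NAW_τ(d)` increase with `τ`. [folklore] -/
theorem inv_nawMemGrowth_monotone [NeZero d] : Monotone fun τ : ℕ => (nawMemGrowth d τ)⁻¹ :=
  fun _ τ₂ h => inv_anti₀ (nawMemGrowth_pos τ₂) (nawMemGrowth_antitone h d)

/-- **The B2 column converges to exactly `1/μ_NAW(ℤ^d)`**. [folklore] -/
theorem tendsto_inv_nawMemGrowth [NeZero d] :
    Tendsto (fun τ : ℕ => (nawMemGrowth d τ)⁻¹) atTop (𝓝 (nawConst d)⁻¹) :=
  (tendsto_nawMemGrowth (d := d)).inv₀ nawConst_pos.ne'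

/-- The rungs are bounded above (by `1/μ_NAW`). [folklore] -/
theorem bddAbove_inv_nawMemGrowth [NeZero d] : BddAbove (Set.range fun τ : ℕ => (nawMemGrowth d τ)⁻¹) :=
  ⟨(nawConst d)⁻¹, by
    rintro _ ⟨τ, rfl⟩
    exact inv_anti₀ nawConst_pos (nawConst_le_nawMemGrowth d τ)⟩

/-- **The limit of the B2 column is its supremum and equals `1/μ_NAW(ℤ^d)`** (IDENTIFIED in closed form; itself a bound by
`inv_nawConst_le_siteCriticalProb`). [folklore] -/
theorem iSup_inv_nawMemGrowth [NeZero d] : ⨆ τ : ℕ, (nawMemGrowth d τ)⁻¹ = (nawConst d)⁻¹ :=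
  tendsto_nhds_unique (tendsto_atTop_ciSup inv_nawMemGrowth_monotone bddAbove_inv_nawMemGrowth) tendsto_inv_nawMemGrowth

end Summit.CriticalPhenomena.PercolationContinuityZ3.Theorems.Pcint.NawTail
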